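import Literature.Computability.Complexity.Counting
import Literature.Computability.Complexity.CNF
import Literature.Computability.Complexity.StackBricks
import Literature.Computability.Complexity.StringEquality
import HarnessLib

/-!
# Counting reductions: parsimonious and right-bit-shift reducibility, `#SAT`, `#3SAT`

Complexity core (`Literature.CplxCore`), counting complexity beyond `Counting.lean` (`SharpP`,
Cook-hardness `IsSharpPHardFun`): the two *function* reducibilities under which concrete counting
problems are proved `#P`-complete in the literature, and the counting versions of satisfiability.

Source followed: Liśkiewicz–Ogihara–Toda, *The complexity of counting self-avoiding walks in
subgraphs of two-dimensional grids and hypercubes*, TCS 304 (2003), §2.2–§2.3 (held: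
`paper:doi-10-1016-s0304-3975-03-00080-x`, pp. 7–8):

* §2.2: "`f` is polynomial-time one-Turing reducible to `g` … if there is a pair of polynomial
  time computable functions, `R₁ : Σ* → Σ*` and `R₂ : Σ* × ℕ → ℕ`, such that for all `x`,
  `f(x) = R₂(x, g(R₁(x)))`. … `f` is polynomial-time parsimoniously reducible to `g` … if for
  all `x` and `y` the above `R₂` satisfies `R₂(x, y) = y`, i.e., for all `x`, `f(x) = g(R₁(x))`.
  … `f` is polynomial-time right-bit-shift reducible to `g` … if there is a polynomial-time
  computable function `R₃ : Σ* → ℕ − {0}` such that … `f(x) = g(R₁(x)) div 2^{R₃(x)}`, where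
  div is integer division. **Proposition 1.** Both `≤ᵖ_{r-shift}`-reductions and
  `≤ᵖ_{parsimonious}`-reductions are transitive."
* §2.3: "A 3CNF formula (respectively, a 3̄CNF formula) is a boolean formula in the
  conjunctive normal form such that each clause has exactly three (respectively, at most
  three) literals. … #SAT (respectively, #3SAT and #3̄SAT) is the problem of computing the
  number of satisfying assignments of boolean formulas (respectively, 3CNF formulas and 3̄CNF
  formulas). … **Proposition 2** (Valiant [26]). #SAT, #3SAT, and #3̄SAT are each complete
  for `#P` under polynomial-time parsimonious reductions." ([26] = Valiant, SIAM J. Comput. 8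
  (1979) 410–421, not held.)

## What is here

* `ParsimoniousReducible f g` (`f ≤ᵖ_pars g`), `RShiftReducible f g` (`f ≤ᵖ_{r-shift} g`) over the
  tree's `FP` (the shift amount `R₃` as the binary numeral `encodeNat ∘ R₃ ∈ FP`);
  `IsSharpPCompleteParsimonious`, `IsSharpPCompleteRShift`;
* **Proposition 1 PROVED**: `ParsimoniousReducible.trans`, `RShiftReducible.trans` (shift
  amounts add: `(y div 2^b) div 2^a = y div 2^(b+a)`, the sum numeral by the brick
  `Brick.addFn`), and the mixed forms `ParsimoniousReducible.trans_rShift`,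
  `RShiftReducible.trans_parsimonious` (a parsimonious reduction is not literally an
  r-shift one, since `R₃ ≥ 1`, so both mixed forms are recorded);
* `CNF.IsWidthEq k` ("each clause has exactly `k` literals"), `CNF.numSat φ` (the number of
  satisfying assignments of the variables occurring in `φ`), the string functions `SHARPSAT`,
  `SHARP3SAT`, `SHARP3SATLE` (`#SAT`, `#3SAT`, `#3̄SAT`; non-codes ↦ `0`);
* **Proposition 2 as a named fact** `Valiant1979_sharpSAT_parsimonious` (not proved: it is the
  parsimonious Cook–Levin theorem; the tree's `CookLevinSAT.lean` proves the decision version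
  `SAT_isNPHard_holds` only).

## Library search / duplication note

`lean search 'Parsimonious|parsimonious' --decl` (Mathlib): nothing. In the tree, the barrier
files `Literature/Barriers/CriticalPhenomena/GridSAWCountingSharpPComplete.lean`
(`GridSAW.RShiftReducible`, `GridSAW.IsSharpPCompleteRShift`) and
`GridSAWCountingViaGridHamPath.lean` (`GridSAW.ParsimoniousReducible` and Proposition 1, landed
while this file was being written) carry copies with the SAME bodies as the definitions below, in
the namespace `Literature.Barriers.CriticalPhenomena.GridSAW`; the bridges are `Iff.rfl` and have to be
recorded barrier-side (a `Complexity` file cannot import a `Barriers` file). The reviewer of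
p13187 asked for these notions to live in `Literature/Computability/Complexity/` once the
Lemma-4 sub-DAG starts — this is that start; the barrier-side copies are the ones to be turned
into aliases (librarian). Counting of satisfying assignments: the tree has `countWitnesses`
(strings of a fixed length) and `CMMSAInstance.satCount` (formulas satisfied by ONE assignment),
neither of which is `#SAT`.

## Design notes

* `numSat φ` counts assignments of `φ.vars` (the variables that occur), extended by `false`
  elsewhere — the intrinsic reading of "number of satisfying assignments" for a formula given
  as a bare clause list (a formula "on `n` variables" all of which occur has the same count;
  the Cook–Levin formulas of `CookLevinSAT.lean` use sparse unary variable names, for which a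
  count over `Fin numVars` would be wrong by a power of two).
* `SHARP3SAT` uses `IsWidthEq 3` (exactly three literals, repetitions allowed, as printed in
  LOT2003 §2.3), `SHARP3SATLE` uses the tree's `IsWidthLE 3`.
-/

namespace Literature.Computability.Complexity

open _root_.Computability

/-! ### Parsimonious and right-bit-shift reductions (§2.2) -/

/-- **`f ≤ᵖ_pars g`** (polynomial-time parsimonious reducibility of counting functions): there is
a polynomial-time `R₁ : Σ* → Σ*` with `f(x) = g(R₁(x))` for all `x` — the case `R₂(x, y) = y`
of a polynomial-time one-Turing reduction. [cite: LiskiewiczOgiharaToda2003, §2.2] -/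
def ParsimoniousReducible (f g : List Bool → ℕ) : Prop :=
  ∃ R₁ : List Bool → List Bool, R₁ ∈ FP ∧ ∀ x, f x = g (R₁ x)

/-- **`f ≤ᵖ_{r-shift} g`** (polynomial-time right-bit-shift reducibility): there are
polynomial-time `R₁ : Σ* → Σ*` and `R₃ : Σ* → ℕ − {0}` (as the binary numeral
`encodeNat (R₃ x)`) with `f(x) = g(R₁(x)) div 2^{R₃(x)}` for all `x`. Same body as the barrier
file's `GridSAW.RShiftReducible`. [cite: LiskiewiczOgiharaToda2003, §2.2] -/
def RShiftReducible (f g : List Bool → ℕ) : Prop :=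
  ∃ R₁ : List Bool → List Bool, R₁ ∈ FP ∧
    ∃ R₃ : List Bool → ℕ, (encodeNat ∘ R₃) ∈ FP ∧ (∀ x, 0 < R₃ x) ∧
      ∀ x, f x = g (R₁ x) / 2 ^ (R₃ x)

/-- `g` is **complete for `#P` under parsimonious reductions**: `g ∈ #P` and every `f ∈ #P` is
`≤ᵖ_pars`-reducible to `g`. [cite: LiskiewiczOgiharaToda2003, §2.2–§2.3 (Prop. 2)] -/
def IsSharpPCompleteParsimonious (g : List Bool → ℕ) : Prop :=
  g ∈ SharpP ∧ ∀ f ∈ SharpP, ParsimoniousReducible f g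

/-- `g` is **complete for `#P` under `≤ᵖ_{r-shift}`-reductions**: `g ∈ #P` and every `f ∈ #P`
is `≤ᵖ_{r-shift}`-reducible to `g` (same body as the barrier file's
`GridSAW.IsSharpPCompleteRShift`). [cite: LiskiewiczOgiharaToda2003, §2.2 and Lemma 4] -/
def IsSharpPCompleteRShift (g : List Bool → ℕ) : Prop :=
  g ∈ SharpP ∧ ∀ f ∈ SharpP, RShiftReducible f g

/-- `≤ᵖ_pars` is reflexive (`R₁ = id`). [cite: LiskiewiczOgiharaToda2003, §2.2] -/
theorem ParsimoniousReducible.refl (f : List Bool → ℕ) : ParsimoniousReducible f f :=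
  ⟨id, PolyTimeComputable.id _, fun _ => rfl⟩

/-- **Proposition 1 (parsimonious half)**: `≤ᵖ_pars` is transitive — compose the two maps
(`FP` is closed under composition, `comp_mem_FP`). [cite: LiskiewiczOgiharaToda2003, Proposition 1] -/
theorem ParsimoniousReducible.trans {f g h : List Bool → ℕ} (hfg : ParsimoniousReducible f g)
    (hgh : ParsimoniousReducible g h) : ParsimoniousReducible f h := by
  obtain ⟨R, hR, hf⟩ := hfg
  obtain ⟨S, hS, hg⟩ := hgh
  exact ⟨S ∘ R, comp_mem_FP hS hR, fun x => by rw [hf x, hg (R x)]; rfl⟩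

/-- A parsimonious reduction followed by an r-shift reduction is an r-shift reduction (same shift).
[cite: LiskiewiczOgiharaToda2003, Proposition 1] -/
theorem ParsimoniousReducible.trans_rShift {f g h : List Bool → ℕ}
    (hfg : ParsimoniousReducible f g) (hgh : RShiftReducible g h) : RShiftReducible f h := by
  obtain ⟨R, hR, hf⟩ := hfg
  obtain ⟨S, hS, T, hT, hTpos, hg⟩ := hgh
  refine ⟨S ∘ R, comp_mem_FP hS hR, T ∘ R, ?_, fun x => hTpos (R x), fun x => ?_⟩
  · exact comp_mem_FP hT hR
  · rw [hf x, hg (R x)]; rfl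

/-- An r-shift reduction followed by a parsimonious reduction is an r-shift reduction.
[cite: LiskiewiczOgiharaToda2003, Proposition 1] -/
theorem RShiftReducible.trans_parsimonious {f g h : List Bool → ℕ}
    (hfg : RShiftReducible f g) (hgh : ParsimoniousReducible g h) : RShiftReducible f h := by
  obtain ⟨R, hR, T, hT, hTpos, hf⟩ := hfg
  obtain ⟨S, hS, hg⟩ := hgh
  refine ⟨S ∘ R, comp_mem_FP hS hR, T, hT, hTpos, fun x => ?_⟩
  rw [hf x, hg (R x)]; rfl

/-- The sum of two polynomial-time numerals is polynomial time:
`x ↦ ⌜a x + b x⌝ ∈ FP` for `⌜a⌝, ⌜b⌝ ∈ FP` (`Brick.addFn ∘ fanoutFn`).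
[cite: AroraBarak2009, §1.3 (closure under composition)] -/
theorem encodeNat_add_mem_FP {a b : List Bool → ℕ} (ha : (encodeNat ∘ a) ∈ FP)
    (hb : (encodeNat ∘ b) ∈ FP) : (encodeNat ∘ fun x => a x + b x) ∈ FP := by
  have h : (encodeNat ∘ fun x => a x + b x) =
      Brick.addFn ∘ fanoutFn (encodeNat ∘ a) (encodeNat ∘ b) := by
    funext x
    simp [fanoutFn_apply, Brick.addFn_boolPair]
  rw [h]
  exact comp_mem_FP Brick.addFn_mem_FP (fanoutFn_mem_FP ha hb)

/-- **Proposition 1 (r-shift half)**: `≤ᵖ_{r-shift}` is transitive — the maps compose and the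
shift amounts add, `(y div 2^b) div 2^a = y div 2^(b + a)`, the sum being polynomial time in
binary (`encodeNat_add_mem_FP`). [cite: LiskiewiczOgiharaToda2003, Proposition 1] -/
theorem RShiftReducible.trans {f g h : List Bool → ℕ} (hfg : RShiftReducible f g)
    (hgh : RShiftReducible g h) : RShiftReducible f h := by
  obtain ⟨R, hR, A, hA, hApos, hf⟩ := hfg
  obtain ⟨S, hS, B, hB, -, hg⟩ := hgh
  refine ⟨S ∘ R, comp_mem_FP hS hR, fun x => B (R x) + A x, ?_, fun x => ?_, fun x => ?_⟩
  · exact encodeNat_add_mem_FP (comp_mem_FP hB hR) hA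
  · exact Nat.add_pos_right _ (hApos x)
  · rw [hf x, hg (R x), Nat.div_div_eq_div_mul, ← pow_add]; rfl

/-- Completeness transfers along a parsimonious reduction into a `#P` function.
[cite: LiskiewiczOgiharaToda2003, Proposition 1] -/
theorem IsSharpPCompleteParsimonious.of_parsimonious {g h : List Bool → ℕ}
    (hg : IsSharpPCompleteParsimonious g) (hgh : ParsimoniousReducible g h) (hh : h ∈ SharpP) :
    IsSharpPCompleteParsimonious h :=
  ⟨hh, fun f hf => (hg.2 f hf).trans hgh⟩

/-- r-shift completeness transfers along an r-shift reduction into a `#P` function.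
[cite: LiskiewiczOgiharaToda2003, Proposition 1] -/
theorem IsSharpPCompleteRShift.of_rShift {g h : List Bool → ℕ}
    (hg : IsSharpPCompleteRShift g) (hgh : RShiftReducible g h) (hh : h ∈ SharpP) :
    IsSharpPCompleteRShift h :=
  ⟨hh, fun f hf => (hg.2 f hf).trans hgh⟩

/-- Parsimonious-complete problems are r-shift-hard targets: if every `#P` function reduces
parsimoniously to `g` and `g ≤ᵖ_{r-shift} h ∈ #P`, then `h` is r-shift complete.
[cite: LiskiewiczOgiharaToda2003, Proposition 1 and proof of Lemma 4] -/
theorem IsSharpPCompleteParsimonious.isSharpPCompleteRShift_of_rShift {g h : List Bool → ℕ}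
    (hg : IsSharpPCompleteParsimonious g) (hgh : RShiftReducible g h) (hh : h ∈ SharpP) :
    IsSharpPCompleteRShift h :=
  ⟨hh, fun f hf => (hg.2 f hf).trans_rShift hgh⟩

/-! ### Number of satisfying assignments; `#SAT`, `#3SAT`, `#3̄SAT` (§2.3) -/

namespace CNF

variable {ν : Type*}

/-- `φ` is a `k`CNF in the sense of LOT2003 §2.3: "each clause has exactly `k` literals"
(repeated literals allowed; compare the tree's `IsWidthLE k` = "at most `k`", i.e. `k̄`CNF, and
`IsExactWidth k` = exactly `k` literals on distinct variables). [cite: LiskiewiczOgiharaToda2003, §2.3] -/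
def IsWidthEq (k : ℕ) (φ : CNF ν) : Prop :=
  ∀ c ∈ φ, c.length = k

/-- Decidability of `IsWidthEq`. [folklore] -/
instance (k : ℕ) (φ : CNF ν) : Decidable (IsWidthEq k φ) := by
  unfold IsWidthEq; infer_instance

/-- A `k`CNF is a `k̄`CNF. [cite: LiskiewiczOgiharaToda2003, §2.3] -/
theorem IsWidthEq.isWidthLE {k : ℕ} {φ : CNF ν} (h : IsWidthEq k φ) : φ.IsWidthLE k :=
  fun c hc => (h c hc).le

/-- An E`k`-CNF (distinct variables) is a `k`CNF. [cite: LiskiewiczOgiharaToda2003, §2.3] -/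
theorem IsExactWidth.isWidthEq {k : ℕ} {φ : CNF ν} (h : φ.IsExactWidth k) : IsWidthEq k φ :=
  fun c hc => (h c hc).1

/-- The total assignment determined by values on the occurring variables (`false` elsewhere).
[cite: AroraBarak2009, Def. 2.9] -/
def extendAssignment (φ : CNF ℕ) (σ : φ.vars → Bool) : ℕ → Bool :=
  fun x => if h : x ∈ φ.vars then σ ⟨x, h⟩ else false

/-- **`#SAT(φ)`**, the number of satisfying assignments of `φ`: assignments of the variables
occurring in `φ` under which `φ` is true. [cite: LiskiewiczOgiharaToda2003, §2.3 (#SAT)] -/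
def numSat (φ : CNF ℕ) : ℕ :=
  (Finset.univ.filter fun σ : φ.vars → Bool => φ.eval (φ.extendAssignment σ) = true).card

/-- `#SAT(φ) ≤ 2^{#vars}`. [folklore] -/
theorem numSat_le (φ : CNF ℕ) : φ.numSat ≤ 2 ^ φ.vars.card := by
  unfold numSat
  refine (Finset.card_filter_le _ _).trans ?_
  simp [Finset.card_univ]

/-- `#SAT(φ) = 0` iff `φ` is unsatisfiable (an assignment can be cut down to the occurring
variables without changing the value of `φ`). [cite: LiskiewiczOgiharaToda2003, §2.3] -/
theorem eval_extendAssignment_restrict (φ : CNF ℕ) (σ : ℕ → Bool) :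
    φ.eval (φ.extendAssignment fun x : φ.vars => σ x) = φ.eval σ := by
  have key : ∀ c ∈ φ, ∀ l ∈ c,
      Literal.eval (φ.extendAssignment fun x : φ.vars => σ x) l = Literal.eval σ l := by
    intro c hc l hl
    have hmem : l.1 ∈ φ.vars := by
      unfold CNF.vars
      rw [List.mem_toFinset, List.mem_map]
      exact ⟨l, List.mem_flatten.2 ⟨c, hc, hl⟩, rfl⟩
    simp [Literal.eval, extendAssignment, hmem]
  rw [Bool.eq_iff_iff, eval_eq_true_iff, eval_eq_true_iff]
  refine forall₂_congr fun c hc => ?_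
  simp only [Clause.eval, List.any_eq_true]
  exact exists_congr fun l => and_congr_right fun hl => by rw [key c hc l hl]

/-- `#SAT(φ) = 0 ↔ φ` unsatisfiable. [cite: LiskiewiczOgiharaToda2003, §2.3] -/
theorem numSat_eq_zero_iff (φ : CNF ℕ) : φ.numSat = 0 ↔ ¬ φ.Satisfiable := by
  unfold numSat CNF.Satisfiable
  rw [Finset.card_eq_zero, Finset.filter_eq_empty_iff]
  constructor
  · rintro h ⟨σ, hσ⟩
    exact h (Finset.mem_univ (fun x : φ.vars => σ x)) (by rw [eval_extendAssignment_restrict, hσ])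
  · intro h σ _ hσ
    exact h ⟨_, hσ⟩

/-- The empty CNF has exactly one satisfying assignment (of its zero variables). [folklore] -/
theorem numSat_nil : numSat ([] : CNF ℕ) = 1 := by
  unfold numSat
  rw [Finset.filter_true_of_mem fun σ _ => eval_nil _, Finset.card_univ, Fintype.card_fun,
    Fintype.card_bool, Fintype.card_coe]
  rfl

/-- Sanity values (by `decide`): `#SAT(x₀) = 1`, `#SAT(x₀ ∨ ¬x₁) = 3`, `#SAT(x₀ ∧ ¬x₀) = 0`,
`#SAT(□) = 0` for the empty clause. [folklore] -/
theorem numSat_examples :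
    numSat [[(0, true)]] = 1 ∧ numSat [[(0, true), (1, false)]] = 3 ∧
      numSat [[(0, true)], [(0, false)]] = 0 ∧ numSat [[]] = 0 := by
  decide

end CNF

/-- Counting function of a property of CNFs on strings: decode, test, count (`0` on non-codes and
on rejected formulas). [cite: LiskiewiczOgiharaToda2003, §2.3] -/
def cnfCountFn (ok : CNF ℕ → Prop) [DecidablePred ok] : List Bool → ℕ := fun w =>
  match encodingCNF.decode w with
  | some φ => if ok φ then φ.numSat else 0
  | none => 0

/-- `cnfCountFn ok` on a code word. [cite: LiskiewiczOgiharaToda2003, §2.3] -/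
theorem cnfCountFn_encode (ok : CNF ℕ → Prop) [DecidablePred ok] (φ : CNF ℕ) :
    cnfCountFn ok (encodingCNF.encode φ) = if ok φ then φ.numSat else 0 := by
  simp [cnfCountFn, encodingCNF.decode_encode]

/-- **`#SAT : {0,1}* → ℕ`**: the number of satisfying assignments of the CNF coded by the input
(`encodingCNF`), `0` on non-codes. [cite: LiskiewiczOgiharaToda2003, §2.3 (#SAT)] -/
def SHARPSAT : List Bool → ℕ :=
  cnfCountFn fun _ => True

/-- **`#3SAT`**: the same on 3CNF formulas (each clause has exactly three literals), `0`
otherwise. [cite: LiskiewiczOgiharaToda2003, §2.3 (#3SAT)] -/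
def SHARP3SAT : List Bool → ℕ :=
  cnfCountFn (CNF.IsWidthEq 3)

/-- **`#3̄SAT`**: the same on 3̄CNF formulas (each clause has at most three literals), `0`
otherwise. [cite: LiskiewiczOgiharaToda2003, §2.3 (#3̄SAT)] -/
def SHARP3SATLE : List Bool → ℕ :=
  cnfCountFn (CNF.IsWidthLE 3)

/-- `#SAT` on a code word is `numSat`. [cite: LiskiewiczOgiharaToda2003, §2.3] -/
theorem SHARPSAT_encode (φ : CNF ℕ) : SHARPSAT (encodingCNF.encode φ) = φ.numSat := by
  simp [SHARPSAT, cnfCountFn_encode]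

/-- `#3SAT` on the code of a 3CNF is `numSat`. [cite: LiskiewiczOgiharaToda2003, §2.3] -/
theorem SHARP3SAT_encode {φ : CNF ℕ} (h : CNF.IsWidthEq 3 φ) :
    SHARP3SAT (encodingCNF.encode φ) = φ.numSat := by
  simp [SHARP3SAT, cnfCountFn_encode, h]

/-- `#3̄SAT` on the code of a 3̄CNF is `numSat`. [cite: LiskiewiczOgiharaToda2003, §2.3] -/
theorem SHARP3SATLE_encode {φ : CNF ℕ} (h : φ.IsWidthLE 3) :
    SHARP3SATLE (encodingCNF.encode φ) = φ.numSat := by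
  simp [SHARP3SATLE, cnfCountFn_encode, h]

/-- `#3SAT ≤ᵖ_pars #3̄SAT` is NOT by the identity map on this encoding (a non-3CNF 3̄CNF code is
sent to `0` by `#3SAT` but counted by `#3̄SAT`); what does hold pointwise is agreement on 3CNF
codes. [cite: LiskiewiczOgiharaToda2003, §2.3] -/
theorem SHARP3SATLE_encode_of_isWidthEq {φ : CNF ℕ} (h : CNF.IsWidthEq 3 φ) :
    SHARP3SATLE (encodingCNF.encode φ) = SHARP3SAT (encodingCNF.encode φ) := by
  rw [SHARP3SAT_encode h, SHARP3SATLE_encode h.isWidthLE]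

/-- **Proposition 2 of LOT2003 (Valiant 1979)**, named fact: `#SAT`, `#3SAT` and `#3̄SAT` are each
complete for `#P` under polynomial-time parsimonious reductions (membership in `#P` and
hardness). Not proved here: hardness is the parsimonious Cook–Levin theorem (the tree proves the
decision version, `SAT_isNPHard_holds`). Stated for this file's encoding `encodingCNF` and the
count `CNF.numSat` over occurring variables.
[cite: LiskiewiczOgiharaToda2003, Proposition 2] [cite: Valiant1979Enumeration, not held (cited via LOT2003 Prop. 2)] -/
def Valiant1979_sharpSAT_parsimonious : Prop :=
  IsSharpPCompleteParsimonious SHARPSAT ∧ IsSharpPCompleteParsimonious SHARP3SAT ∧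
    IsSharpPCompleteParsimonious SHARP3SATLE

/-- Corollary form used downstream (Lemma 4 of LOT2003 starts from `#3SAT`): every `#P` function
is parsimoniously reducible to `#3SAT`. [cite: LiskiewiczOgiharaToda2003, Proposition 2] -/
theorem Valiant1979_sharpSAT_parsimonious.sharp3SAT_hard (h : Valiant1979_sharpSAT_parsimonious)
    {f : List Bool → ℕ} (hf : f ∈ SharpP) : ParsimoniousReducible f SHARP3SAT :=
  h.2.1.2 f hf

/-- With Proposition 2, an r-shift reduction of `#3SAT` to a `#P` function `h` makes `h` complete
for `#P` under `≤ᵖ_{r-shift}` (the way Lemma 4 and Theorem 7 of LOT2003 are obtained).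
[cite: LiskiewiczOgiharaToda2003, Proposition 1, Proposition 2, Lemma 4] -/
theorem Valiant1979_sharpSAT_parsimonious.isSharpPCompleteRShift
    (h : Valiant1979_sharpSAT_parsimonious) {g : List Bool → ℕ}
    (hg : RShiftReducible SHARP3SAT g) (hmem : g ∈ SharpP) : IsSharpPCompleteRShift g :=
  h.2.1.isSharpPCompleteRShift_of_rShift hg hmem

end Literature.Computability.Complexity
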